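import Summits.Langlands.Langlands.Theorems.IrreducibilityBySelfDualityReciprocityUpToIrreducibilityGeometricConstituentsDevissage
import HarnessLib

/-!
# Dévissage with the change of frame AND the comparison maps recorded
(support item stmt-Langlands-31696 `WeilRestrictionSplit.WeilRestrictionConstituent`, helper file 1)

For a group `G`, a field `k`, a homomorphism `ψ : G →* GL_n(k)` and a `G`-stable subspace `W` of
`kⁿ` (ANY: `W = 0` and `W = kⁿ` are allowed, the corresponding block then has size `0`), a basis of
`kⁿ` adapted to a decomposition `kⁿ = W ⊕ C` gives a change of frame `P ∈ GL_n(k)` with ALL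
`P ψ(g) P⁻¹` block upper triangular `(A(g) B(g); 0 D(g))` along `Fin m ⊕ Fin p ≃ Fin n`
(`m = dim W`), TOGETHER WITH the two comparison maps that identify the diagonal blocks as the
sub-representation and the quotient representation: an injective `k`-linear
`α : kᵐ → kⁿ` with image `W` and `ψ(g) · α(x) = α(A(g) · x)`, and a surjective `k`-linear
`β : kⁿ → kᵖ` with kernel `W` and `β(ψ(g) · v) = D(g) · β(v)`
(`exists_conj_blockTriangular_recorded`).  This is the tree's
`ReciprocityUpToIrreducibility.exists_conj_blockTriangular_of_subrepresentation` (Curtis–Reiner,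
*Methods* I, §16B) with the adapted basis exported as the maps `α` (coordinates on `W`) and `β`
(coordinates transverse to `W`); it is what arguments that LOCATE a given sub-representation inside a
diagonal block (Frobenius reciprocity for constituents, Jordan–Hölder bookkeeping) consume.  Also:
the trace of a block upper triangular matrix (`trace_reindex_fromBlocks`) and of a conjugate framed
representation (`trace_conj`).

References: C. W. Curtis, I. Reiner, *Methods of Representation Theory* I (1981), §16B (adapted bases);
J.-P. Serre, *Linear representations of finite groups* (1977), §1.3.
-/

noncomputable section

set_option linter.dupNamespace false -- project-wide option (lakefile weak.linter.dupNamespace); `Summit.Langlands.Langlands` is the mandated namespace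

open scoped MatrixGroups
open Matrix Module

namespace Summit.Langlands.Langlands.Theorems.WeilRestrictionConstituentProof

universe u v

section Trace

variable {k : Type u} [CommRing k]

/-- The trace does not see a relabelling of rows and columns by the same equivalence. [folklore] -/
theorem trace_reindex {ι κ : Type*} [Fintype ι] [Fintype κ] (e : ι ≃ κ) (X : Matrix ι ι k) :
    (Matrix.reindex e e X).trace = X.trace := by
  simp only [Matrix.trace, Matrix.diag, Matrix.reindex_apply, Matrix.submatrix_apply]
  exact e.symm.sum_comp (fun i => X i i)

/-- The trace of a block matrix is the sum of the traces of its diagonal blocks. [folklore] -/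
theorem trace_fromBlocks {ι κ : Type*} [Fintype ι] [Fintype κ] (A : Matrix ι ι k)
    (B : Matrix ι κ k) (C : Matrix κ ι k) (D : Matrix κ κ k) :
    (Matrix.fromBlocks A B C D).trace = A.trace + D.trace := by
  simp [Matrix.trace, Matrix.diag, Fintype.sum_sum_type]

/-- The trace of a relabelled block upper triangular matrix is the sum of the traces of its two
diagonal blocks. [folklore] -/
theorem trace_reindex_fromBlocks {ι κ ν : Type*} [Fintype ι] [Fintype κ] [Fintype ν]
    (e : ι ⊕ κ ≃ ν) (A : Matrix ι ι k) (B : Matrix ι κ k) (C : Matrix κ ι k) (D : Matrix κ κ k) :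
    (Matrix.reindex e e (Matrix.fromBlocks A B C D)).trace = A.trace + D.trace := by
  rw [trace_reindex, trace_fromBlocks]

variable [TopologicalSpace k] [IsTopologicalRing k] {G : Type v} [Group G] [TopologicalSpace G]

/-- The character of a framed representation does not see the frame:
`tr (P ρ P⁻¹)(g) = tr ρ(g)`. [folklore] -/
theorem trace_conj {n : ℕ} (P : GL (Fin n) k)
    (ρ : Literature.NumberTheory.GaloisRepresentations.FramedRep G k n) (g : G) :
    Literature.NumberTheory.GaloisRepresentations.FramedRep.trace
        (Literature.NumberTheory.GaloisRepresentations.FramedRep.conj P ρ) g =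
      Literature.NumberTheory.GaloisRepresentations.FramedRep.trace ρ g := by
  simp only [Literature.NumberTheory.GaloisRepresentations.FramedRep.trace,
    Literature.NumberTheory.GaloisRepresentations.FramedRep.conj_apply, Units.val_mul]
  exact Matrix.trace_units_conj P _

end Trace

section Algebraic

variable {k : Type u} [Field k] {G : Type v} [Group G]

/-- **Dévissage with the change of frame and the comparison maps recorded.**  Let
`ψ : G →* GL_n(k)` and let `W ⊆ kⁿ` be stable under all `ψ(g)`.  Then there are `m + p = n` with
`m = dim W`, a relabelling `e : Fin m ⊕ Fin p ≃ Fin n`, a change of frame `P ∈ GL_n(k)` and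
matrix valued functions `A`, `B`, `D` with `P ψ(g) P⁻¹ = e·(A(g) B(g); 0 D(g))·e⁻¹` for every
`g` — the matrices of `ψ(g)` in a basis adapted to `kⁿ = W ⊕ C`
(`basis_toMatrix_mul_linearMap_toMatrix_mul_basis_toMatrix`) — and moreover:
an injective linear `α : kᵐ → kⁿ` with image exactly `W` and `ψ(g)·α(x) = α(A(g)·x)` (the
coordinates along the `W`-part of the adapted basis: the upper diagonal block IS the
sub-representation `W`), and a surjective linear `β : kⁿ → kᵖ` with kernel exactly `W` and
`β(ψ(g)·v) = D(g)·β(v)` (the coordinates along the complement: the lower diagonal block IS the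
quotient representation `kⁿ/W`).  Curtis–Reiner, *Methods* I, §16B. [folklore] -/
theorem exists_conj_blockTriangular_recorded {n : ℕ} (ψ : G →* GL (Fin n) k)
    (W : Subrepresentation
      ((Representation.ofDistribMulAction k (GL (Fin n) k) (Fin n → k)).comp ψ)) :
    ∃ (m p : ℕ) (_ : m + p = n) (e : Fin m ⊕ Fin p ≃ Fin n) (P : GL (Fin n) k)
      (A : G → Matrix (Fin m) (Fin m) k) (B : G → Matrix (Fin m) (Fin p) k)
      (D : G → Matrix (Fin p) (Fin p) k),
      Module.finrank k W.toSubmodule = m ∧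
      (∀ g, ((P * ψ g * P⁻¹ : GL (Fin n) k) : Matrix (Fin n) (Fin n) k) =
          Matrix.reindex e e (Matrix.fromBlocks (A g) (B g) 0 (D g))) ∧
      (∃ α : (Fin m → k) →ₗ[k] (Fin n → k), Function.Injective α ∧
          LinearMap.range α = W.toSubmodule ∧
          ∀ g x, ((ψ g : GL (Fin n) k) : Matrix (Fin n) (Fin n) k) *ᵥ α x = α (A g *ᵥ x)) ∧
      (∃ β : (Fin n → k) →ₗ[k] (Fin p → k), Function.Surjective β ∧
          LinearMap.ker β = W.toSubmodule ∧
          ∀ g v, β (((ψ g : GL (Fin n) k) : Matrix (Fin n) (Fin n) k) *ᵥ v) = D g *ᵥ β v) := by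
  classical
  -- adapted from `ReciprocityUpToIrreducibility.exists_conj_blockTriangular_of_subrepresentation`
  let R : Representation k G (Fin n → k) :=
    (Representation.ofDistribMulAction k (GL (Fin n) k) (Fin n → k)).comp ψ
  have hRapply : ∀ (g : G) (v : Fin n → k),
      R g v = ((ψ g : GL (Fin n) k) : Matrix (Fin n) (Fin n) k) *ᵥ v := fun _ _ ↦ rfl
  have hRlin : ∀ g, (R g : (Fin n → k) →ₗ[k] (Fin n → k)) =
      Matrix.toLin' ((ψ g : GL (Fin n) k) : Matrix (Fin n) (Fin n) k) := fun g ↦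
    LinearMap.ext fun v ↦ by rw [Matrix.toLin'_apply, hRapply]
  -- a complement `C` of the stable subspace `W`, dimensions
  obtain ⟨C, hWC⟩ := Submodule.exists_isCompl W.toSubmodule
  obtain ⟨m, hm⟩ : ∃ m, finrank k W.toSubmodule = m := ⟨_, rfl⟩
  obtain ⟨p, hp⟩ : ∃ p, finrank k C = p := ⟨_, rfl⟩
  have hmp : m + p = n := by
    rw [← hm, ← hp, Submodule.finrank_add_eq_of_isCompl hWC, Module.finrank_fin_fun]
  -- an adapted basis `b`
  let bW : Module.Basis (Fin m) k W.toSubmodule := Module.finBasisOfFinrankEq k W.toSubmodule hm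
  let bC : Module.Basis (Fin p) k C := Module.finBasisOfFinrankEq k C hp
  let f : (W.toSubmodule × C) ≃ₗ[k] (Fin n → k) := Submodule.prodEquivOfIsCompl W.toSubmodule C hWC
  let b : Module.Basis (Fin m ⊕ Fin p) k (Fin n → k) := (bW.prod bC).map f
  have hrepr : ∀ w : Fin n → k, w ∈ W.toSubmodule → ∀ i : Fin p, b.repr w (Sum.inr i) = 0 := by
    intro w hw i
    have h1 : b.repr w = (bW.prod bC).repr (f.symm w) := by
      simp only [b, Module.Basis.map_repr, LinearEquiv.trans_apply]
    have h2 : f.symm w = ((⟨w, hw⟩ : W.toSubmodule), 0) :=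
      Submodule.prodEquivOfIsCompl_symm_apply_left (p := W.toSubmodule) (q := C) hWC
        (⟨w, hw⟩ : W.toSubmodule)
    rw [h1, h2, Module.Basis.prod_repr_inr]
    simp
  have hb_inl : ∀ j : Fin m, (b (Sum.inl j) : Fin n → k) ∈ W.toSubmodule := by
    intro j
    have : b (Sum.inl j) = f ((bW.prod bC) (Sum.inl j)) := by simp [b]
    rw [this, Submodule.coe_prodEquivOfIsCompl', Module.Basis.prod_apply_inl_fst,
      Module.Basis.prod_apply_inl_snd]
    simp
  -- membership in `W` = vanishing of the coordinates along `bC`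
  have hmemW : ∀ v : Fin n → k, v ∈ W.toSubmodule ↔ ∀ i : Fin p, b.repr v (Sum.inr i) = 0 := by
    intro v
    refine ⟨hrepr v, fun hv ↦ ?_⟩
    rw [← b.sum_repr v, Fintype.sum_sum_type]
    refine W.toSubmodule.add_mem (W.toSubmodule.sum_mem fun j _ ↦
      W.toSubmodule.smul_mem _ (hb_inl j)) ?_
    rw [Finset.sum_eq_zero fun i _ ↦ by rw [hv i, zero_smul]]
    exact W.toSubmodule.zero_mem
  let e : Fin m ⊕ Fin p ≃ Fin n := finSumFinEquiv.trans (finCongr hmp)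
  let b' : Module.Basis (Fin n) k (Fin n → k) := b.reindex e
  -- the change of frame: `P = (b' → e₀)`, `P⁻¹ = (e₀ → b')`
  let e₀ : Module.Basis (Fin n) k (Fin n → k) := Pi.basisFun k (Fin n)
  let Pm : Matrix (Fin n) (Fin n) k := b'.toMatrix e₀
  let Qm : Matrix (Fin n) (Fin n) k := e₀.toMatrix b'
  have hPQ : Pm * Qm = 1 := Module.Basis.toMatrix_mul_toMatrix_flip _ _
  have hQP : Qm * Pm = 1 := Module.Basis.toMatrix_mul_toMatrix_flip _ _
  let P : GL (Fin n) k := ⟨Pm, Qm, hPQ, hQP⟩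
  -- the matrix of `ψ g` in the adapted basis and its blocks
  let M : G → Matrix (Fin m ⊕ Fin p) (Fin m ⊕ Fin p) k := fun g ↦ LinearMap.toMatrix b b (R g)
  have h21 : ∀ g, (M g).toBlocks₂₁ = 0 := by
    intro g
    ext i j
    change LinearMap.toMatrix b b (R g) (Sum.inr i) (Sum.inl j) = 0
    rw [LinearMap.toMatrix_apply]
    exact hrepr _ (W.apply_mem_toSubmodule g (hb_inl j)) i
  have hblock : ∀ g, M g =
      Matrix.fromBlocks (M g).toBlocks₁₁ (M g).toBlocks₁₂ 0 (M g).toBlocks₂₂ := by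
    intro g
    conv_lhs => rw [← Matrix.fromBlocks_toBlocks (M g), h21]
  -- the adapted matrix acts on coordinates
  have hMv : ∀ g (v : Fin n → k), M g *ᵥ b.equivFun v = b.equivFun (R g v) := by
    intro g v
    rw [Module.Basis.equivFun_apply, Module.Basis.equivFun_apply]
    exact LinearMap.toMatrix_mulVec_repr b b (R g) v
  refine ⟨m, p, hmp, e, P, fun g ↦ (M g).toBlocks₁₁, fun g ↦ (M g).toBlocks₁₂,
    fun g ↦ (M g).toBlocks₂₂, hm, fun g ↦ ?_, ?_, ?_⟩
  · -- `P ψ(g) P⁻¹` is the matrix of `ψ g` in the basis `b'`, i.e. `M g` reindexed along `e`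
    have h1 : LinearMap.toMatrix e₀ e₀ (R g : (Fin n → k) →ₗ[k] (Fin n → k)) =
        ((ψ g : GL (Fin n) k) : Matrix (Fin n) (Fin n) k) := by
      rw [hRlin, show LinearMap.toMatrix e₀ e₀ = LinearMap.toMatrix' from
        LinearMap.toMatrix_eq_toMatrix', LinearMap.toMatrix'_toLin']
    have h2 : ((P * ψ g * P⁻¹ : GL (Fin n) k) : Matrix (Fin n) (Fin n) k) =
        LinearMap.toMatrix b' b' (R g) := by
      change Pm * ((ψ g : GL (Fin n) k) : Matrix (Fin n) (Fin n) k) * Qm = _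
      simp only [Pm, Qm]
      rw [← h1, basis_toMatrix_mul_linearMap_toMatrix_mul_basis_toMatrix]
    have h3 : LinearMap.toMatrix b' b' (R g) = Matrix.reindex e e (M g) := by
      ext i j
      simp only [b', M, LinearMap.toMatrix_apply, Module.Basis.repr_reindex_apply,
        Module.Basis.reindex_apply, Matrix.reindex_apply, Matrix.submatrix_apply]
    rw [h2, h3]
    exact congrArg _ (hblock g)
  · -- `α` : coordinates along `bW`
    let L : (Fin m → k) →ₗ[k] (Fin m ⊕ Fin p → k) :=
      { toFun := fun x ↦ Sum.elim x 0
        map_add' := fun x y ↦ by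
          ext i; rcases i with i | i <;> simp
        map_smul' := fun c x ↦ by
          ext i; rcases i with i | i <;> simp }
    have hL : ∀ x, L x = Sum.elim x 0 := fun _ ↦ rfl
    let α : (Fin m → k) →ₗ[k] (Fin n → k) := b.equivFun.symm.toLinearMap ∘ₗ L
    have hα : ∀ x, b.equivFun (α x) = Sum.elim x 0 := fun x ↦ by
      simp only [α, LinearMap.coe_comp, LinearEquiv.coe_coe, Function.comp_apply,
        LinearEquiv.apply_symm_apply, hL]
    refine ⟨α, fun x y hxy ↦ ?_, ?_, fun g x ↦ ?_⟩
    · have h := hα y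
      rw [← hxy, hα] at h
      funext j
      simpa using congrFun h (Sum.inl j)
    · apply le_antisymm
      · rintro _ ⟨x, rfl⟩
        rw [hmemW]
        intro i
        have h := congrFun (hα x) (Sum.inr i)
        rw [Module.Basis.equivFun_apply] at h
        rw [h, Sum.elim_inr, Pi.zero_apply]
      · intro w hw
        refine ⟨b.equivFun w ∘ Sum.inl, b.equivFun.injective ?_⟩
        rw [hα]
        funext i
        rcases i with j | i
        · rfl
        · rw [Sum.elim_inr, Pi.zero_apply, Module.Basis.equivFun_apply, hrepr w hw i]
    · apply b.equivFun.injective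
      rw [← hRapply, ← hMv, hα, hα, hblock, Matrix.fromBlocks_mulVec]
      funext i
      rcases i with j | i
      · simp
      · simp
  · -- `β` : coordinates along `bC`
    let β : (Fin n → k) →ₗ[k] (Fin p → k) :=
      LinearMap.funLeft k k Sum.inr ∘ₗ b.equivFun.toLinearMap
    have hβ : ∀ v, β v = b.equivFun v ∘ Sum.inr := fun _ ↦ rfl
    refine ⟨β, fun y ↦ ⟨b.equivFun.symm (Sum.elim 0 y), ?_⟩, ?_, fun g v ↦ ?_⟩
    · rw [hβ, LinearEquiv.apply_symm_apply, Sum.elim_comp_inr]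
    · ext v
      rw [LinearMap.mem_ker, hmemW, hβ, funext_iff]
      simp only [Function.comp_apply, Pi.zero_apply, Module.Basis.equivFun_apply]
    · rw [hβ, hβ, ← hRapply, ← hMv, hblock, ← Sum.elim_comp_inl_inr (b.equivFun v),
        Matrix.fromBlocks_mulVec, Sum.elim_comp_inr, Sum.elim_comp_inl, Sum.elim_comp_inr,
        Matrix.zero_mulVec, zero_add]

end Algebraic

end Summit.Langlands.Langlands.Theorems.WeilRestrictionConstituentProof

end
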